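import Mathlib
import Literature.NumberTheory.Irrationality.Fischler2002.EulerKernelLowerBoundsProofs
import Literature.NumberTheory.Irrationality.Fischler2002.JnFinitenessUpperProofs
import HarnessLib

/-!
# Fischler's finiteness criterion for `𝒥(p)` — IV: both halves and the criterion (`Jn_finite_iff`)

Topic `Literature/NumberTheory/Irrationality/Fischler2002`; proofs-only companion of `RhinViolaGroupsGeneral.lean`, whose
NAMED FACT `Jn_finite_iff` (Fischler's finiteness criterion for the `n`-fold integrals `𝒥(p)`, every `n ≥ 2`) is
DISCHARGED here as `Jn_finite_iff_holds`. Source: S. Fischler, « Formes linéaires en polyzêtas et intégrales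
multiples », C. R. Acad. Sci. Paris Sér. I **335** (2002) 1–4 = arXiv:math/0202064 [Fischler2002Polyzetas], §3 p. 4:
« On pose ρ_n = c_n − b_n et ρ_{n−1} = c_{n−1} − 1 − b_{n−1}, puis ρ_k = ρ⁺_{k+2} + c_k − 1 − b_k … avec la convention
c₁ = 1. Alors l'intégrale 𝒥(p) est finie si et seulement si on a a_k ≥ 0, b_k ≥ 0 et ρ_k ≤ a_{k−1} pour tout
k ∈ {1,…,n}, avec la convention a₀ = 0 »; proof in print: S. Fischler, *Groupes de Rhin-Viola et intégrales multiples*,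
J. Théor. Nombres Bordeaux **15** (2003) 479–534 [Fischler2003RhinViola], §4.1 Proposition 13 (cell `pub-zeta5`,
seat ct-1 g32, 2026-08-27).

HONEST FRAMING (cells pub-zeta5 / zeta5-irr): systematic search; no irrationality claim unless certified. A convergence
criterion for a family of multiple integrals of non-negative functions (real analysis: Tonelli + one-variable
estimates); not an irrationality statement; nothing about `ζ(5)`.

## The two halves
«IF»: the integer criterion supplies real exponents `r_k = ρ_k⁺ + (n+3−k)ε`, `ε = 1/(2(n+2))`, meeting the strict
inequalities of `lintegral_phi_lt_top`, and `integrandJ ≤ Φ_n` on the open cube (`Jn_ne_top_of_finitenessCriterionGen`).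
«ONLY IF»: with the EXACT extra exponents `r_k = ρ_k⁺` the peeled integrands `Φ_m` of `JnFinitenessUpperProofs.lean` satisfy
`∫ Φ_{m+1} ≥ c·∫ Φ_m` (Euler-kernel LOWER bound `∫₀¹ t^a(1−t)^b(1−tδ)^{−g}dt ≥ c(1−δ)^{−(g−b−1)⁺}` with
`(g−b−1)⁺ = ρ_{m+1}⁺`), and `∫ Φ_{m+1} = ∞` as soon as `a_{m+1} − ρ⁺_{m+2} ≤ −1` or `b_{m+1} ≤ −1` (DIVERGENCE of the
kernel on every fibre, fibres of full measure); induction on `m` (`phi_conditions_of_lintegral_lt_top`) yields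
`a_k ≥ ρ⁺_{k+1}`, `b_k ≥ 0` at every level and `b₁ ≥ ρ₃⁺` — exactly the printed criterion (`c̃₁ = 1` convention).
Both halves together: `Jn_finite_iff_holds`. Theorems only, no definition,
no new named fact (net debt −1).
-/

noncomputable section

namespace Literature.NumberTheory.Irrationality.Fischler2002

open MeasureTheory Set Finset JnChi
open scoped ENNReal

namespace JnFinite

/-! ### Divergence and lower bounds transported through the peeling -/

/-- If an `ℝ≥0∞`-valued function is `∞` at every point of the open cube `(0,1)^m`, its integral over the cube is `∞`.
[cite: Fischler2003RhinViola, §4.1 Proposition 13 (divergence on every fibre)] -/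
theorem setLIntegral_openCube_eq_top {m : ℕ} {F : (Fin m → ℝ) → ℝ≥0∞}
    (hF : ∀ x ∈ (Set.pi Set.univ fun _ : Fin m => Ioo (0 : ℝ) 1), F x = ∞) :
    ∫⁻ x in (Set.pi Set.univ fun _ : Fin m => Ioo (0 : ℝ) 1), F x = ∞ := by
  refine eq_top_iff.2 ?_
  calc (⊤ : ℝ≥0∞) = ∫⁻ _ in (Set.pi Set.univ fun _ : Fin m => Ioo (0 : ℝ) 1), (⊤ : ℝ≥0∞) := by
        rw [setLIntegral_const, volume_openCube, mul_one]
    _ ≤ _ := setLIntegral_mono' (measurableSet_openCube m) fun x hx => (hF x hx).ge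

/-- **The conditions forced by finiteness.** For real exponent functions with
`r_k = (γ_k + r_{k+2} − β_k − 1)⁺` (`2 ≤ k ≤ n`): if `∫_{(0,1)^m} Φ_m < ∞` (`1 ≤ m ≤ n`) then
`α_k − r_{k+1} > −1` (`1 ≤ k ≤ m`), `β_k > −1` (`2 ≤ k ≤ m`) and `β₁ − γ₁ − r₃ > −1` — induction on `m`: the last
variable's Euler kernel diverges on every fibre unless the two top conditions hold, and otherwise is bounded below by
`c·(1 − δ_m)^{−r_{m+1}}`, which recombines to `c·Φ_m`. [cite: Fischler2003RhinViola, §4.1 Proposition 13 (récurrence sur n)] -/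
theorem phi_conditions_of_lintegral_lt_top (n : ℕ) (α β γ r : ℕ → ℝ)
    (hρ : ∀ k, 2 ≤ k → k ≤ n → r k = max (γ k + r (k + 2) - β k - 1) 0) :
    ∀ m, 1 ≤ m → m ≤ n →
      ∫⁻ x in (Set.pi Set.univ fun _ : Fin m => Ioo (0 : ℝ) 1),
        ENNReal.ofReal ((∏ k ∈ Icc 1 m, coord x k ^ α k * (1 - coord x k) ^ β k * deltaV x k ^ (-γ k)) *
          (coord x m ^ (-r (m + 1)) * deltaV x (m - 1) ^ (-r (m + 1)) * deltaV x m ^ (-r (m + 2)))) < ∞ →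
      (∀ k, 1 ≤ k → k ≤ m → -1 < α k - r (k + 1)) ∧ (∀ k, 2 ≤ k → k ≤ m → -1 < β k) ∧
        -1 < β 1 - γ 1 - r 3 := by
  intro m hm hmn
  induction m with
  | zero => omega
  | succ m ih =>
    intro hfin
    rcases Nat.eq_zero_or_pos m with rfl | hmpos
    · -- one variable: a Beta integral, finite iff both exponents exceed `−1`
      rw [lintegral_openCube_succ _ (measurable_phi α β γ r (0 + 1)).ennreal_ofReal] at hfin
      have hinner : ∀ x' : Fin 0 → ℝ,
          ∫⁻ t in Ioo (0 : ℝ) 1, ENNReal.ofReal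
            ((∏ k ∈ Icc 1 (0 + 1), coord (Fin.snoc x' t : Fin (0 + 1) → ℝ) k ^ α k *
                (1 - coord (Fin.snoc x' t : Fin (0 + 1) → ℝ) k) ^ β k *
                deltaV (Fin.snoc x' t : Fin (0 + 1) → ℝ) k ^ (-γ k)) *
              (coord (Fin.snoc x' t : Fin (0 + 1) → ℝ) (0 + 1) ^ (-r (0 + 1 + 1)) *
                deltaV (Fin.snoc x' t : Fin (0 + 1) → ℝ) (0 + 1 - 1) ^ (-r (0 + 1 + 1)) *
                deltaV (Fin.snoc x' t : Fin (0 + 1) → ℝ) (0 + 1) ^ (-r (0 + 1 + 2)))) =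
            ∫⁻ t in Ioo (0 : ℝ) 1, ENNReal.ofReal
              (t ^ (α 1 - r 2) * (1 - t) ^ (β 1 - γ 1 - r 3) * (1 - t * 0) ^ (-(0 : ℝ))) := by
        intro x'
        refine setLIntegral_congr_fun measurableSet_Ioo fun t ht => ?_
        rw [phi_one α β γ r x' ht, mul_zero, sub_zero, neg_zero, Real.rpow_zero, mul_one]
      simp only [hinner] at hfin
      rw [setLIntegral_const, volume_openCube, mul_one] at hfin
      have hA : -1 < α 1 - r 2 := by
        by_contra h
        rw [not_lt] at h
        rw [lintegral_eulerKernel_eq_top_of_le_left h _ _ le_rfl zero_lt_one] at hfin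
        exact lt_irrefl _ hfin
      have hB : -1 < β 1 - γ 1 - r 3 := by
        by_contra h
        rw [not_lt] at h
        rw [lintegral_eulerKernel_eq_top_of_le_right _ h _ le_rfl zero_lt_one] at hfin
        exact lt_irrefl _ hfin
      refine ⟨fun k hk1 hk2 => ?_, fun k hk1 hk2 => by omega, hB⟩
      obtain rfl : k = 1 := by omega
      exact hA
    · -- peel the last variable
      rw [lintegral_openCube_succ _ (measurable_phi α β γ r (m + 1)).ennreal_ofReal] at hfin
      -- the fibre integrals
      have hfibre : ∀ x' ∈ (Set.pi Set.univ fun _ : Fin m => Ioo (0 : ℝ) 1),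
          ∫⁻ t in Ioo (0 : ℝ) 1, ENNReal.ofReal
            ((∏ k ∈ Icc 1 (m + 1), coord (Fin.snoc x' t : Fin (m + 1) → ℝ) k ^ α k *
                (1 - coord (Fin.snoc x' t : Fin (m + 1) → ℝ) k) ^ β k *
                deltaV (Fin.snoc x' t : Fin (m + 1) → ℝ) k ^ (-γ k)) *
              (coord (Fin.snoc x' t : Fin (m + 1) → ℝ) (m + 1) ^ (-r (m + 1 + 1)) *
                deltaV (Fin.snoc x' t : Fin (m + 1) → ℝ) (m + 1 - 1) ^ (-r (m + 1 + 1)) *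
                deltaV (Fin.snoc x' t : Fin (m + 1) → ℝ) (m + 1) ^ (-r (m + 1 + 2)))) =
            ENNReal.ofReal ((∏ k ∈ Icc 1 m, coord x' k ^ α k * (1 - coord x' k) ^ β k * deltaV x' k ^ (-γ k)) *
                deltaV x' m ^ (-r (m + 2))) *
              ∫⁻ t in Ioo (0 : ℝ) 1, ENNReal.ofReal (t ^ (α (m + 1) - r (m + 2)) * (1 - t) ^ β (m + 1) *
                (1 - t * deltaV x' m) ^ (-(γ (m + 1) + r (m + 3)))) := by
        intro x' hx'
        have hx := mem_openCube_iff.1 hx'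
        have hG0 : 0 ≤ (∏ k ∈ Icc 1 m, coord x' k ^ α k * (1 - coord x' k) ^ β k * deltaV x' k ^ (-γ k)) *
            deltaV x' m ^ (-r (m + 2)) :=
          mul_nonneg (phiProd_pos α β γ hx).le (Real.rpow_nonneg (deltaV_mem hx m le_rfl).1.le _)
        rw [← lintegral_const_mul' _ _ ENNReal.ofReal_ne_top]
        refine setLIntegral_congr_fun measurableSet_Ioo fun t ht => ?_
        rw [phi_snoc α β γ r hmpos hx ht, ENNReal.ofReal_mul hG0]
      -- the two top conditions, by divergence on every fibre
      have hA : -1 < α (m + 1) - r (m + 2) := by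
        by_contra h
        rw [not_lt] at h
        refine absurd hfin (not_lt.2 (setLIntegral_openCube_eq_top fun x' hx' => ?_).ge)
        have hx := mem_openCube_iff.1 hx'
        obtain ⟨hδ0, -, hδ1⟩ := deltaV_mem hx m le_rfl
        rw [hfibre x' hx', lintegral_eulerKernel_eq_top_of_le_left h _ _ hδ0.le (hδ1 hmpos), ENNReal.mul_top]
        rw [ne_eq, ENNReal.ofReal_eq_zero, not_le]
        exact mul_pos (phiProd_pos α β γ hx) (Real.rpow_pos_of_pos hδ0 _)
      have hB : -1 < β (m + 1) := by
        by_contra h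
        rw [not_lt] at h
        refine absurd hfin (not_lt.2 (setLIntegral_openCube_eq_top fun x' hx' => ?_).ge)
        have hx := mem_openCube_iff.1 hx'
        obtain ⟨hδ0, -, hδ1⟩ := deltaV_mem hx m le_rfl
        rw [hfibre x' hx', lintegral_eulerKernel_eq_top_of_le_right _ h _ hδ0.le (hδ1 hmpos), ENNReal.mul_top]
        rw [ne_eq, ENNReal.ofReal_eq_zero, not_le]
        exact mul_pos (phiProd_pos α β γ hx) (Real.rpow_pos_of_pos hδ0 _)
      -- the lower bound on every fibre: `∫ Φ_{m+1} ≥ c · ∫ Φ_m`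
      obtain ⟨c, hc, hcb⟩ := le_lintegral_eulerKernel (α (m + 1) - r (m + 2)) (γ (m + 1) + r (m + 3)) hB
      have hexp : max (γ (m + 1) + r (m + 3) - β (m + 1) - 1) 0 = r (m + 1) :=
        (hρ (m + 1) (by omega) hmn).symm
      have hlow : ENNReal.ofReal c * ∫⁻ x' in (Set.pi Set.univ fun _ : Fin m => Ioo (0 : ℝ) 1),
          ENNReal.ofReal ((∏ k ∈ Icc 1 m, coord x' k ^ α k * (1 - coord x' k) ^ β k * deltaV x' k ^ (-γ k)) *
            (coord x' m ^ (-r (m + 1)) * deltaV x' (m - 1) ^ (-r (m + 1)) * deltaV x' m ^ (-r (m + 2)))) < ∞ := by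
        rw [← lintegral_const_mul' _ _ ENNReal.ofReal_ne_top]
        refine lt_of_le_of_lt (setLIntegral_mono' (measurableSet_openCube m) fun x' hx' => ?_) hfin
        have hx := mem_openCube_iff.1 hx'
        obtain ⟨hδ0, -, hδ1⟩ := deltaV_mem hx m le_rfl
        have hG0 : 0 ≤ (∏ k ∈ Icc 1 m, coord x' k ^ α k * (1 - coord x' k) ^ β k * deltaV x' k ^ (-γ k)) *
            deltaV x' m ^ (-r (m + 2)) :=
          mul_nonneg (phiProd_pos α β γ hx).le (Real.rpow_nonneg hδ0.le _)
        have hk := hcb (deltaV x' m) hδ0.le (hδ1 hmpos)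
        rw [hexp] at hk
        rw [hfibre x' hx']
        calc ENNReal.ofReal c * ENNReal.ofReal
              ((∏ k ∈ Icc 1 m, coord x' k ^ α k * (1 - coord x' k) ^ β k * deltaV x' k ^ (-γ k)) *
                (coord x' m ^ (-r (m + 1)) * deltaV x' (m - 1) ^ (-r (m + 1)) * deltaV x' m ^ (-r (m + 2))))
            = ENNReal.ofReal ((∏ k ∈ Icc 1 m, coord x' k ^ α k * (1 - coord x' k) ^ β k * deltaV x' k ^ (-γ k)) *
                deltaV x' m ^ (-r (m + 2))) * ENNReal.ofReal (c * (1 - deltaV x' m) ^ (-r (m + 1))) := by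
              rw [← phi_factor α β γ r hmpos hx, ← ENNReal.ofReal_mul hc.le, ← ENNReal.ofReal_mul hG0]
              ring_nf
          _ ≤ _ := mul_le_mul' le_rfl hk
      have hfin' : ∫⁻ x' in (Set.pi Set.univ fun _ : Fin m => Ioo (0 : ℝ) 1),
          ENNReal.ofReal ((∏ k ∈ Icc 1 m, coord x' k ^ α k * (1 - coord x' k) ^ β k * deltaV x' k ^ (-γ k)) *
            (coord x' m ^ (-r (m + 1)) * deltaV x' (m - 1) ^ (-r (m + 1)) * deltaV x' m ^ (-r (m + 2)))) < ∞ := by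
        by_contra h
        rw [not_lt, top_le_iff] at h
        rw [h, ENNReal.mul_top (by rwa [ne_eq, ENNReal.ofReal_eq_zero, not_le])] at hlow
        exact lt_irrefl _ hlow
      obtain ⟨h1, h2, h3⟩ := ih hmpos (by omega) hfin'
      refine ⟨fun k hk1 hk2 => ?_, fun k hk1 hk2 => ?_, h3⟩
      · rcases Nat.lt_or_ge k (m + 1) with hk | hk
        · exact h1 k hk1 (by omega)
        · obtain rfl : k = m + 1 := le_antisymm hk2 hk
          exact hA
      · rcases Nat.lt_or_ge k (m + 1) with hk | hk
        · exact h2 k hk1 (by omega)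
        · obtain rfl : k = m + 1 := le_antisymm hk2 hk
          exact hB

/-! ### The «if» half of the criterion -/

/-- **Fischler's finiteness criterion, «if» half**: for `n ≥ 2`, if `a_k ≥ 0`, `b_k ≥ 0` and `ρ_k ≤ a_{k−1}` for all
`k ∈ {1,…,n}` (`a₀ = 0`), then `𝒥(p) < ∞`. The real exponents `r_k = ρ_k⁺ + (n+3−k)ε`, `ε = 1/(2(n+2))`, meet the
strict inequalities of `lintegral_phi_lt_top`, and `integrandJ ≤ Φ_n` on the open cube.
[cite: Fischler2002Polyzetas, §3 p. 4 (critère de finitude)] [cite: Fischler2003RhinViola, §4.1 Proposition 13] -/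
theorem Jn_ne_top_of_finitenessCriterionGen {n : ℕ} (hn : 2 ≤ n) (p : Exponents)
    (h : FinitenessCriterionGen n p) : Jn n p ≠ ∞ := by
  obtain ⟨ha, hb, hρ⟩ := h
  -- the real exponents
  set ε : ℝ := 1 / (2 * ((n : ℝ) + 2)) with hε
  have hε0 : 0 < ε := by rw [hε]; positivity
  have hεn : ((n : ℝ) + 2) * ε = 1 / 2 := by rw [hε]; field_simp
  set α : ℕ → ℝ := fun k => (p.a k : ℝ) with hαd
  set β : ℕ → ℝ := fun k => (p.b k : ℝ) with hβd
  set γ : ℕ → ℝ := fun k => if k = 1 then (0 : ℝ) else (cTilde n p k : ℝ) with hγd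
  set r : ℕ → ℝ := fun k => ((max (rho n p k) 0 : ℤ) : ℝ) + ((n + 3 - k : ℕ) : ℝ) * ε with hrd
  -- slack bounds
  have hslack : ∀ k, 1 ≤ k → ((n + 3 - k : ℕ) : ℝ) * ε < 1 := by
    intro k hk
    have : ((n + 3 - k : ℕ) : ℝ) ≤ (n : ℝ) + 2 := by
      have : n + 3 - k ≤ n + 2 := by omega
      exact_mod_cast this
    nlinarith
  have hr0 : ∀ k, 0 ≤ r k := fun k => by
    simp only [hrd]
    have : (0 : ℝ) ≤ ((max (rho n p k) 0 : ℤ) : ℝ) := by exact_mod_cast le_max_right _ _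
    positivity
  -- `a_k ≥ ρ⁺_{k+1}`
  have haρ : ∀ k, 1 ≤ k → k ≤ n → ((max (rho n p (k + 1)) 0 : ℤ) : ℝ) ≤ (p.a k : ℝ) := by
    intro k hk1 hkn
    have h0 := ha k (Finset.mem_Icc.2 ⟨hk1, hkn⟩)
    have : max (rho n p (k + 1)) 0 ≤ p.a k := by
      refine max_le ?_ h0
      rcases lt_or_ge n (k + 1) with hlt | hle
      · rw [rho_of_lt p hlt]; exact h0
      · have := hρ (k + 1) (Finset.mem_Icc.2 ⟨by omega, hle⟩)
        rw [if_neg (by omega), show k + 1 - 1 = k from rfl] at this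
        exact this
    exact_mod_cast this
  have hfin := lintegral_phi_lt_top n α β γ r hr0 ?_ ?_ ?_ ?_ n (by omega) le_rfl
  rotate_left
  · -- hα
    intro k hk1 hkn
    simp only [hαd, hrd]
    have := haρ k hk1 hkn
    have := hslack (k + 1) (by omega)
    linarith
  · -- hβ
    intro k hk2 hkn
    simp only [hβd]
    have : (0 : ℝ) ≤ (p.b k : ℝ) := by exact_mod_cast hb k (Finset.mem_Icc.2 ⟨by omega, hkn⟩)
    linarith
  · -- hγ
    intro k hk2 hkn
    simp only [hγd, hβd, hrd, if_neg (show k ≠ 1 by omega)]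
    have hrec := rho_of_le p hkn
    have hcast : (rho n p k : ℝ) = ((max (rho n p (k + 2)) 0 : ℤ) : ℝ) + (cTilde n p k : ℝ) - 1 - (p.b k : ℝ) := by
      rw [hrec]; push_cast; ring
    have hmax : (rho n p k : ℝ) ≤ ((max (rho n p k) 0 : ℤ) : ℝ) := by exact_mod_cast le_max_left _ _
    have hsl : ((n + 3 - (k + 2) : ℕ) : ℝ) * ε < ((n + 3 - k : ℕ) : ℝ) * ε := by
      have : ((n + 3 - (k + 2) : ℕ) : ℝ) < ((n + 3 - k : ℕ) : ℝ) := by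
        have : n + 3 - (k + 2) < n + 3 - k := by omega
        exact_mod_cast this
      nlinarith
    linarith
  · -- h1
    simp only [hβd, hγd, hrd, if_pos rfl]
    have hrec := rho_of_le p (show 1 ≤ n by omega)
    have h0 := hρ 1 (Finset.mem_Icc.2 ⟨le_rfl, by omega⟩)
    rw [if_pos rfl] at h0
    have hc1 : cTilde n p 1 = 1 := by rw [cTilde, if_pos rfl]
    have hcast : ((max (rho n p 3) 0 : ℤ) : ℝ) ≤ (p.b 1 : ℝ) := by
      have : max (rho n p (1 + 2)) 0 ≤ p.b 1 := by rw [hrec, hc1] at h0; linarith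
      exact_mod_cast this
    have := hslack 3 (by omega)
    linarith
  -- compare `integrandJ` with `Φ_n` on the open cube
  unfold Jn
  rw [← setLIntegral_congr (openCube_ae_eq_unitCube n)]
  refine (lt_of_le_of_lt (setLIntegral_mono' (measurableSet_openCube n) fun x hx' => ?_) hfin).ne
  have hx := mem_openCube_iff.1 hx'
  refine ENNReal.ofReal_le_ofReal ?_
  rw [integrandJ_eq_rpow_prod hn p hx]
  exact prod_le_phi α β γ r hr0 (by omega) hx

/-! ### The criterion -/

/-- **Fischler's finiteness criterion, «only if» half**: for `n ≥ 2`, if `𝒥(p) < ∞` then `a_k ≥ 0`, `b_k ≥ 0` and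
`ρ_k ≤ a_{k−1}` for all `k ∈ {1,…,n}` (`a₀ = 0`).
[cite: Fischler2002Polyzetas, §3 p. 4 (critère de finitude)] [cite: Fischler2003RhinViola, §4.1 Proposition 13] -/
theorem finitenessCriterionGen_of_Jn_ne_top {n : ℕ} (hn : 2 ≤ n) (p : Exponents) (hJ : Jn n p ≠ ∞) :
    FinitenessCriterionGen n p := by
  -- the real exponents, now exact
  set α : ℕ → ℝ := fun k => (p.a k : ℝ) with hαd
  set β : ℕ → ℝ := fun k => (p.b k : ℝ) with hβd
  set γ : ℕ → ℝ := fun k => if k = 1 then (0 : ℝ) else (cTilde n p k : ℝ) with hγd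
  set r : ℕ → ℝ := fun k => ((max (rho n p k) 0 : ℤ) : ℝ) with hrd
  have hρ : ∀ k, 2 ≤ k → k ≤ n → r k = max (γ k + r (k + 2) - β k - 1) 0 := by
    intro k hk2 hkn
    simp only [hrd, hγd, hβd, if_neg (show k ≠ 1 by omega)]
    rw [Int.cast_max, Int.cast_zero, rho_of_le p hkn]
    push_cast
    ring_nf
  have hrn1 : r (n + 1) = 0 := by simp only [hrd]; rw [rho_of_lt p (by omega)]; simp
  have hrn2 : r (n + 2) = 0 := by simp only [hrd]; rw [rho_of_lt p (by omega)]; simp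
  -- `𝒥(p) = ∫ Φ_n`
  have hJ' : ∫⁻ x in (Set.pi Set.univ fun _ : Fin n => Ioo (0 : ℝ) 1),
      ENNReal.ofReal ((∏ k ∈ Icc 1 n, coord x k ^ α k * (1 - coord x k) ^ β k * deltaV x k ^ (-γ k)) *
        (coord x n ^ (-r (n + 1)) * deltaV x (n - 1) ^ (-r (n + 1)) * deltaV x n ^ (-r (n + 2)))) < ∞ := by
    have hJn : Jn n p = ∫⁻ x in (Set.pi Set.univ fun _ : Fin n => Ioo (0 : ℝ) 1),
        ENNReal.ofReal ((∏ k ∈ Icc 1 n, coord x k ^ α k * (1 - coord x k) ^ β k * deltaV x k ^ (-γ k)) *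
          (coord x n ^ (-r (n + 1)) * deltaV x (n - 1) ^ (-r (n + 1)) * deltaV x n ^ (-r (n + 2)))) := by
      unfold Jn
      rw [← setLIntegral_congr (openCube_ae_eq_unitCube n)]
      refine setLIntegral_congr_fun (measurableSet_openCube n) fun x hx' => ?_
      have hx := mem_openCube_iff.1 hx'
      rw [integrandJ_eq_rpow_prod hn p hx, hrn1, hrn2, neg_zero, Real.rpow_zero, Real.rpow_zero, Real.rpow_zero]
      simp only [hαd, hβd, hγd, mul_one]
    rw [← hJn]
    exact lt_top_iff_ne_top.2 hJ
  obtain ⟨h1, h2, h3⟩ := phi_conditions_of_lintegral_lt_top n α β γ r hρ n (by omega) le_rfl hJ'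
  -- back to the integers
  have hA : ∀ k, 1 ≤ k → k ≤ n → max (rho n p (k + 1)) 0 ≤ p.a k := by
    intro k hk1 hkn
    have h := h1 k hk1 hkn
    simp only [hαd, hrd] at h
    have h' : ((max (rho n p (k + 1)) 0 : ℤ) : ℝ) < (p.a k : ℝ) + 1 := by linarith
    have h'' : max (rho n p (k + 1)) 0 < p.a k + 1 := by exact_mod_cast h'
    omega
  have hB : ∀ k, 2 ≤ k → k ≤ n → 0 ≤ p.b k := by
    intro k hk2 hkn
    have h := h2 k hk2 hkn
    simp only [hβd] at h
    have h' : (-1 : ℤ) < p.b k := by exact_mod_cast h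
    omega
  have hC : max (rho n p 3) 0 ≤ p.b 1 := by
    simp only [hβd, hγd, hrd, if_pos rfl, sub_zero] at h3
    have h' : ((max (rho n p 3) 0 : ℤ) : ℝ) < (p.b 1 : ℝ) + 1 := by linarith
    have h'' : max (rho n p 3) 0 < p.b 1 + 1 := by exact_mod_cast h'
    omega
  refine ⟨fun k hk => ?_, fun k hk => ?_, fun k hk => ?_⟩
  · have hk' := Finset.mem_Icc.1 hk
    exact le_trans (le_max_right _ _) (hA k hk'.1 hk'.2)
  · have hk' := Finset.mem_Icc.1 hk
    rcases Nat.lt_or_ge k 2 with hk1 | hk2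
    · obtain rfl : k = 1 := by omega
      exact le_trans (le_max_right _ _) hC
    · exact hB k hk2 hk'.2
  · have hk' := Finset.mem_Icc.1 hk
    rcases Nat.lt_or_ge k 2 with hk1 | hk2
    · obtain rfl : k = 1 := by omega
      rw [if_pos rfl, rho_of_le p hk'.2, cTilde, if_pos rfl, show (1 : ℕ) + 2 = 3 from rfl]
      have := hC
      omega
    · rw [if_neg (by omega)]
      have h := hA (k - 1) (by omega) (by omega)
      rw [show k - 1 + 1 = k by omega] at h
      exact le_trans (le_max_left _ _) h

end JnFinite

/-- **Fischler's finiteness criterion holds** (the named fact `Jn_finite_iff` of `RhinViolaGroupsGeneral.lean` is a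
theorem): for every `n ≥ 2` and `p ∈ ℤ^{3n−1}`, `𝒥(p)` is finite if and only if `a_k ≥ 0`, `b_k ≥ 0` and
`ρ_k ≤ a_{k−1}` for all `k ∈ {1,…,n}` (`a₀ = 0`, `c̃₁ = 1`).
[cite: Fischler2002Polyzetas, §3 p. 4 (critère de finitude de 𝒥(p))] [cite: Fischler2003RhinViola, §4.1 Proposition 13 p. 521] -/
theorem Jn_finite_iff_holds : Jn_finite_iff := fun _ p hn =>
  ⟨JnFinite.finitenessCriterionGen_of_Jn_ne_top hn p, JnFinite.Jn_ne_top_of_finitenessCriterionGen hn p⟩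

end Literature.NumberTheory.Irrationality.Fischler2002

end
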